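import Mathlib.Combinatorics.SetFamily.FourFunctions
import Mathlib.Data.Real.Basic
import Mathlib.Data.Fintype.Powerset
import Mathlib.Tactic.Linarith
import Mathlib.Tactic.Ring
import Mathlib.Tactic.FieldSimp
import Mathlib.Algebra.BigOperators.Ring.Finset
import HarnessLib

/-!
# Coefficientwise (two-colouring) positivity of Harris' inequality — the first rung of prim-lf-2's coefficientwise programme

Support file (`--supports stmt-CriticalPhenomena-4575`, closed), prover `prim-lf-2` (gen 21).  No definitions, no named facts, no sorries;
standard axioms.  Memo `prim-lf-2/DC-gen21.md` §2b–§2d.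

Context.  A `k`-mass correlation functional of Bernoulli bond percolation, `F(p) = E[Ψ(ω₁,…,ω_k)]` over `k` independent copies, is a polynomial of
degree `≤ k` in every edge weight; its joint Bernstein coefficients are the conditional expectations of `Ψ` given the per-edge count profile of the
copies, and all of them are `≥ 0` ("coefficientwise positivity") iff `E[Ψ] ≥ 0` under the UNIFORM measure on count-respecting colourings of the edges
of every minor.  prim-lf-2 gen 21 found by exact census that Harris, van den Berg–Häggström–Kahn's conditional association, the tree's `COV(τ)` and
the Question-8 pocket covariance comparison `PCOV_K` are all coefficientwise positive (0 negatives), and proved it for Harris.  This file is that proof,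
in its combinatorial form: for the uniform two-colouring `ω ⊆ E`, `ω̄ = E ∖ ω`, and monotone `f, g`,
  `Σ_{ω ⊆ E} (f ω − f ω̄)(g ω − g ω̄) ≥ 0`,
i.e. `E[f(ω)g(ω)] ≥ E[f(ω)g(ω̄)]` — the count-one Bernstein coefficient of `E[fg] − E[f]E[g]` on every minor.
* `Coefficientwise.sum_mul_compl_le` — `2^{|E|} · Σ_ω f(ω) g(ω̄) ≤ (Σ f)(Σ g)` (FKG on the Boolean lattice for `f` and `M − g ∘ compl`);
* `Coefficientwise.harris_twoColouring` — `0 ≤ Σ_ω (f ω − f ω̄)(g ω − g ω̄)` (with Mathlib's `fkg` for the diagonal term).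
Proof = Mathlib's `fkg` (Fortuin–Kasteleyn–Ginibre on a finite distributive lattice) twice with the counting weight.
[cite: KozmaNitzan2024, Questions 8–9 (§5.5 p. 36)]
-/

namespace Summit.CriticalPhenomena.PercolationContinuityZ3.Theorems

open Finset

namespace Coefficientwise

variable {ι : Type*} [Fintype ι] [DecidableEq ι]

/-- FKG with the counting weight on the Boolean lattice `Finset ι`: `(Σ f)(Σ g) ≤ 2^{|ι|}·Σ f g` for monotone nonnegative `f, g`.
[cite: KozmaNitzan2024, §5.5 (context only; the inequality is Fortuin–Kasteleyn–Ginibre / Harris–Kleitman)] -/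
theorem sum_mul_sum_le (f g : Finset ι → ℝ) (hf : Monotone f) (hg : Monotone g) (hf0 : 0 ≤ f) (hg0 : 0 ≤ g) :
    (∑ s : Finset ι, f s) * (∑ s : Finset ι, g s) ≤ (Fintype.card (Finset ι) : ℝ) * ∑ s : Finset ι, f s * g s := by
  have h := fkg (μ := fun _ : Finset ι => (1 : ℝ)) (f := f) (g := g) (fun _ => zero_le_one) hf0 hg0 hf hg
    (fun a b => by simp)
  simpa [Finset.card_univ] using h

/-- The cross term: `2^{|ι|} · Σ_s f(s) g(sᶜ) ≤ (Σ f)(Σ g)` for monotone `f ≥ 0`, `g` (FKG for `f` and the monotone `s ↦ g(univ) − g sᶜ ≥ 0`).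
[cite: KozmaNitzan2024, §5.5 (context only)] -/
theorem sum_mul_compl_le (f g : Finset ι → ℝ) (hf : Monotone f) (hg : Monotone g) (hf0 : 0 ≤ f) :
    (Fintype.card (Finset ι) : ℝ) * ∑ s : Finset ι, f s * g sᶜ ≤ (∑ s : Finset ι, f s) * (∑ s : Finset ι, g s) := by
  -- `M` := the maximum of `g` (attained at `univ`)
  set M : ℝ := g univ with hM
  have hgle : ∀ s : Finset ι, g s ≤ M := fun s => hg (subset_univ s)
  set h : Finset ι → ℝ := fun s => M - g sᶜ with hh
  have hh0 : 0 ≤ h := fun s => by simp only [hh, Pi.zero_apply, sub_nonneg]; exact hgle _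
  have hhmono : Monotone h := by
    intro s t hst
    simp only [hh]
    have : g tᶜ ≤ g sᶜ := hg (compl_subset_compl.mpr hst)
    linarith
  have key := sum_mul_sum_le f h hf hhmono hf0 hh0
  -- Σ h = card·M − Σ g (reindex by complement), Σ f h = M Σ f − Σ f g∘compl
  have hsumg : ∑ s : Finset ι, g sᶜ = ∑ s : Finset ι, g s :=
    Fintype.sum_equiv (Equiv.mk (fun s : Finset ι => sᶜ) (fun s => sᶜ) (fun s => compl_compl s) (fun s => compl_compl s)) _ _
      (fun s => rfl)
  have hsumh : ∑ s : Finset ι, h s = (Fintype.card (Finset ι) : ℝ) * M - ∑ s : Finset ι, g s := by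
    simp only [hh, Finset.sum_sub_distrib, Finset.sum_const, Finset.card_univ, nsmul_eq_mul, hsumg]
  have hsumfh : ∑ s : Finset ι, f s * h s = M * ∑ s : Finset ι, f s - ∑ s : Finset ι, f s * g sᶜ := by
    simp only [hh, mul_sub, Finset.sum_sub_distrib]
    rw [Finset.mul_sum]
    refine congrArg₂ (· - ·) (Finset.sum_congr rfl fun s _ => by ring) rfl
  rw [hsumh, hsumfh] at key
  nlinarith [key]

/-- **Harris' inequality is coefficientwise positive (two-colouring form).**  For monotone `f, g : Finset ι → ℝ`,
`0 ≤ Σ_{s} (f s − f sᶜ)(g s − g sᶜ)` — equivalently `E[f(ω) g(ω)] ≥ E[f(ω) g(ω̄)]` for the uniform `ω ⊆ ι`, `ω̄ = ωᶜ`; this is the count-one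
joint Bernstein coefficient of `E[fg] − E[f]E[g]` (prim-lf-2 DC-gen21 §2c).
[cite: KozmaNitzan2024, Questions 8–9 (§5.5 p. 36) (context)] -/
theorem harris_twoColouring (f g : Finset ι → ℝ) (hf : Monotone f) (hg : Monotone g) :
    0 ≤ ∑ s : Finset ι, (f s - f sᶜ) * (g s - g sᶜ) := by
  -- shift to nonnegative functions (the sum is invariant under adding constants)
  set f' : Finset ι → ℝ := fun s => f s - f ∅ with hf'
  set g' : Finset ι → ℝ := fun s => g s - g ∅ with hg'
  have hf'0 : 0 ≤ f' := fun s => by simp only [hf', Pi.zero_apply, sub_nonneg]; exact hf (empty_subset s)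
  have hg'0 : 0 ≤ g' := fun s => by simp only [hg', Pi.zero_apply, sub_nonneg]; exact hg (empty_subset s)
  have hf'm : Monotone f' := fun s t hst => by simp only [hf']; linarith [hf hst]
  have hg'm : Monotone g' := fun s t hst => by simp only [hg']; linarith [hg hst]
  have hrw : ∑ s : Finset ι, (f s - f sᶜ) * (g s - g sᶜ) = ∑ s : Finset ι, (f' s - f' sᶜ) * (g' s - g' sᶜ) := by
    refine Finset.sum_congr rfl fun s _ => ?_
    simp only [hf', hg']; ring
  rw [hrw]
  -- expand: Σ (f's − f'sᶜ)(g's − g'sᶜ) = 2 Σ f'g' − 2 Σ f'(s) g'(sᶜ) after reindexing the sᶜ-terms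
  have e1 : ∑ s : Finset ι, f' sᶜ * g' sᶜ = ∑ s : Finset ι, f' s * g' s :=
    Fintype.sum_equiv (Equiv.mk (fun s : Finset ι => sᶜ) (fun s => sᶜ) (fun s => compl_compl s) (fun s => compl_compl s)) _ _
      (fun s => rfl)
  have e2 : ∑ s : Finset ι, f' sᶜ * g' s = ∑ s : Finset ι, f' s * g' sᶜ := by
    refine (Fintype.sum_equiv (Equiv.mk (fun s : Finset ι => sᶜ) (fun s => sᶜ) (fun s => compl_compl s) (fun s => compl_compl s)) _ _
      (fun s => ?_))
    simp
  have hexp : ∑ s : Finset ι, (f' s - f' sᶜ) * (g' s - g' sᶜ) =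
      2 * ∑ s : Finset ι, f' s * g' s - 2 * ∑ s : Finset ι, f' s * g' sᶜ := by
    have : ∀ s : Finset ι, (f' s - f' sᶜ) * (g' s - g' sᶜ) = f' s * g' s + f' sᶜ * g' sᶜ - f' s * g' sᶜ - f' sᶜ * g' s :=
      fun s => by ring
    simp only [this, Finset.sum_sub_distrib, Finset.sum_add_distrib, e1, e2]
    ring
  rw [hexp]
  have hA := sum_mul_sum_le f' g' hf'm hg'm hf'0 hg'0
  have hB := sum_mul_compl_le f' g' hf'm hg'm hf'0
  have hcard : (0 : ℝ) < (Fintype.card (Finset ι) : ℝ) := by exact_mod_cast Fintype.card_pos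
  nlinarith [hA, hB, hcard]

/-!
### Cells (prim-lf-2 gen 23): Harris on a cylinder of the cube and the weighted two-colouring inequality

A *cell* of the cube `Finset ι` is a cylinder `{t | t ∩ B = π}` (the coordinates in `B` frozen to the pattern `π`, the others free); it is a
sublattice, so FKG holds on it with the counting weight (`fkg_cell`).  If on a cell both `F` and `G` are, on average, at most their values at
the complementary colouring (`Σ_{cell} F t ≤ Σ_{cell} F tᶜ`), then the two-colouring correlation sum restricted to the cell is `≥ 0`
(`twoColouring_cell_nonneg`): the summands `F t − F tᶜ`, `G t − G tᶜ` are monotone with non-positive cell means.  A pointwise sufficient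
condition is `F t ≤ F ((B \ π) ∪ (t \ B))` on the cell (`twoColouring_cell_nonneg_of_le`).  This is the abstract core of the proof of
prim-lf-2's conjecture (C3) `T(v) = E[1{v ∉ C_x(ω)}·Δf·Δg] ≥ 0` (memo `prim-lf-2/CW-TLEMMA-gen23.md`): the event `{v ∉ C_x(ω)}` is a disjoint
union of cells (red cluster of `v` and its inside colouring frozen) on each of which the red cluster of `x` lives in the free coordinates and the
blue cluster of `x` contains its mirror image.
-/

/-- FKG on a cell `{t | t ∩ B = π}` of the cube with the counting weight: for monotone `Φ, Ψ : Finset ι → ℝ` (any sign),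
`(Σ_{cell} Φ)(Σ_{cell} Ψ) ≤ |cell| · Σ_{cell} Φ Ψ`.  (Mathlib's `fkg` with the log-supermodular weight `1_{cell}`, after shifting `Φ, Ψ` by their
values at `∅`.)  [cite: KozmaNitzan2024, §5.5 (context only; the inequality is Fortuin–Kasteleyn–Ginibre on a sublattice)] -/
theorem fkg_cell (B π : Finset ι) (Φ Ψ : Finset ι → ℝ) (hΦ : Monotone Φ) (hΨ : Monotone Ψ) :
    (∑ t ∈ univ.filter (fun t : Finset ι => t ∩ B = π), Φ t) * (∑ t ∈ univ.filter (fun t : Finset ι => t ∩ B = π), Ψ t) ≤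
      ((univ.filter (fun t : Finset ι => t ∩ B = π)).card : ℝ) * ∑ t ∈ univ.filter (fun t : Finset ι => t ∩ B = π), Φ t * Ψ t := by
  set cell := univ.filter (fun t : Finset ι => t ∩ B = π) with hcell
  -- shifted nonnegative monotone functions
  set Φ' : Finset ι → ℝ := fun t => Φ t - Φ ∅ with hΦ'
  set Ψ' : Finset ι → ℝ := fun t => Ψ t - Ψ ∅ with hΨ'
  have hΦ'0 : 0 ≤ Φ' := fun t => by simp only [hΦ', Pi.zero_apply, sub_nonneg]; exact hΦ (empty_subset t)
  have hΨ'0 : 0 ≤ Ψ' := fun t => by simp only [hΨ', Pi.zero_apply, sub_nonneg]; exact hΨ (empty_subset t)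
  have hΦ'm : Monotone Φ' := fun s t hst => by simp only [hΦ']; linarith [hΦ hst]
  have hΨ'm : Monotone Ψ' := fun s t hst => by simp only [hΨ']; linarith [hΨ hst]
  -- the indicator weight of the cell is log-supermodular (the cell is a sublattice)
  set μ : Finset ι → ℝ := fun t => if t ∩ B = π then 1 else 0 with hμ
  have hμ0 : 0 ≤ μ := fun t => by simp only [hμ, Pi.zero_apply]; split_ifs <;> norm_num
  have hμlat : ∀ a b : Finset ι, μ a * μ b ≤ μ (a ⊓ b) * μ (a ⊔ b) := by
    intro a b
    by_cases ha : a ∩ B = π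
    · by_cases hb : b ∩ B = π
      · have ha' : ∀ i, i ∈ π ↔ i ∈ a ∧ i ∈ B := fun i => by rw [← ha]; exact Finset.mem_inter
        have hb' : ∀ i, i ∈ π ↔ i ∈ b ∧ i ∈ B := fun i => by rw [← hb]; exact Finset.mem_inter
        have h1 : (a ⊓ b) ∩ B = π := by
          ext i
          simp only [Finset.inf_eq_inter, Finset.mem_inter]
          have := ha' i; have := hb' i
          tauto
        have h2 : (a ⊔ b) ∩ B = π := by
          ext i
          simp only [Finset.sup_eq_union, Finset.mem_inter, Finset.mem_union]
          have := ha' i; have := hb' i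
          tauto
        simp only [hμ, ha, hb, h1, h2, if_true]; norm_num
      · simp only [hμ, hb, if_false, mul_zero]; exact mul_nonneg (hμ0 _) (hμ0 _)
    · simp only [hμ, ha, if_false, zero_mul]; exact mul_nonneg (hμ0 _) (hμ0 _)
  have key := fkg (μ := μ) (f := Φ') (g := Ψ') hμ0 hΦ'0 hΨ'0 hΦ'm hΨ'm hμlat
  -- rewrite the weighted sums as sums over the cell
  have hw : ∀ h : Finset ι → ℝ, ∑ t, μ t * h t = ∑ t ∈ cell, h t := by
    intro h
    rw [hcell, Finset.sum_filter]
    refine Finset.sum_congr rfl fun t _ => ?_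
    simp only [hμ]; split_ifs <;> simp
  have hw1 : ∑ t, μ t = (cell.card : ℝ) := by
    have := hw (fun _ => 1)
    simp only [mul_one, Finset.sum_const, nsmul_eq_mul] at this
    simpa using this
  rw [hw Φ', hw Ψ', hw1, hw (fun t => Φ' t * Ψ' t)] at key
  -- expand the shifts
  have e1 : ∑ t ∈ cell, Φ' t = ∑ t ∈ cell, Φ t - (cell.card : ℝ) * Φ ∅ := by
    simp only [hΦ', Finset.sum_sub_distrib, Finset.sum_const, nsmul_eq_mul]
  have e2 : ∑ t ∈ cell, Ψ' t = ∑ t ∈ cell, Ψ t - (cell.card : ℝ) * Ψ ∅ := by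
    simp only [hΨ', Finset.sum_sub_distrib, Finset.sum_const, nsmul_eq_mul]
  have e3 : ∑ t ∈ cell, Φ' t * Ψ' t =
      ∑ t ∈ cell, Φ t * Ψ t - Ψ ∅ * ∑ t ∈ cell, Φ t - Φ ∅ * ∑ t ∈ cell, Ψ t + (cell.card : ℝ) * (Φ ∅ * Ψ ∅) := by
    have : ∀ t, Φ' t * Ψ' t = Φ t * Ψ t - Ψ ∅ * Φ t - Φ ∅ * Ψ t + Φ ∅ * Ψ ∅ := fun t => by simp only [hΦ', hΨ']; ring
    simp only [this, Finset.sum_add_distrib, Finset.sum_sub_distrib, Finset.sum_const, nsmul_eq_mul, ← Finset.mul_sum]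
  rw [e1, e2, e3] at key
  nlinarith [key]

/-- **Weighted two-colouring Harris on a cell.**  For monotone `F, G : Finset ι → ℝ` and a cell `{t | t ∩ B = π}` on which
`Σ F t ≤ Σ F tᶜ` and `Σ G t ≤ Σ G tᶜ` (the cell favours the complementary colouring on average), `0 ≤ Σ_{cell} (F t − F tᶜ)(G t − G tᶜ)`.
Proof: `t ↦ F t − F tᶜ` is monotone with non-positive cell sum; `fkg_cell`.  (prim-lf-2 CW-TLEMMA-gen23 §3.)
[cite: KozmaNitzan2024, Questions 8–9 (§5.5 p. 36) (context)] -/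
theorem twoColouring_cell_nonneg (B π : Finset ι) (F G : Finset ι → ℝ) (hF : Monotone F) (hG : Monotone G)
    (hFc : ∑ t ∈ univ.filter (fun t : Finset ι => t ∩ B = π), F t ≤ ∑ t ∈ univ.filter (fun t : Finset ι => t ∩ B = π), F tᶜ)
    (hGc : ∑ t ∈ univ.filter (fun t : Finset ι => t ∩ B = π), G t ≤ ∑ t ∈ univ.filter (fun t : Finset ι => t ∩ B = π), G tᶜ) :
    0 ≤ ∑ t ∈ univ.filter (fun t : Finset ι => t ∩ B = π), (F t - F tᶜ) * (G t - G tᶜ) := by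
  set cell := univ.filter (fun t : Finset ι => t ∩ B = π) with hcell
  set Φ : Finset ι → ℝ := fun t => F t - F tᶜ with hΦ
  set Ψ : Finset ι → ℝ := fun t => G t - G tᶜ with hΨ
  have hΦm : Monotone Φ := fun s t hst => by
    simp only [hΦ]; linarith [hF hst, hF (compl_subset_compl.mpr hst)]
  have hΨm : Monotone Ψ := fun s t hst => by
    simp only [hΨ]; linarith [hG hst, hG (compl_subset_compl.mpr hst)]
  have key := fkg_cell B π Φ Ψ hΦm hΨm
  have hΦs : ∑ t ∈ cell, Φ t ≤ 0 := by
    simp only [hΦ, Finset.sum_sub_distrib, sub_nonpos]; exact hFc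
  have hΨs : ∑ t ∈ cell, Ψ t ≤ 0 := by
    simp only [hΨ, Finset.sum_sub_distrib, sub_nonpos]; exact hGc
  have hprod : 0 ≤ (∑ t ∈ cell, Φ t) * (∑ t ∈ cell, Ψ t) := mul_nonneg_of_nonpos_of_nonpos hΦs hΨs
  rcases cell.eq_empty_or_nonempty with hce | hne
  · simp [hce]
  · have hcard : (0 : ℝ) < (cell.card : ℝ) := by exact_mod_cast hne.card_pos
    have : 0 ≤ (cell.card : ℝ) * ∑ t ∈ cell, Φ t * Ψ t := le_trans hprod key
    have h2 : 0 ≤ ∑ t ∈ cell, Φ t * Ψ t := by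
      by_contra hlt
      have hlt' : ∑ t ∈ cell, Φ t * Ψ t < 0 := lt_of_not_ge hlt
      have : (cell.card : ℝ) * ∑ t ∈ cell, Φ t * Ψ t < 0 := mul_neg_of_pos_of_neg hcard hlt'
      linarith
    simpa [hΦ, hΨ] using h2

/-- Pointwise form of `twoColouring_cell_nonneg`: if `π ⊆ B` and on the cell `{t | t ∩ B = π}` both `F t ≤ F ((B \ π) ∪ (t \ B))` and
`G t ≤ G ((B \ π) ∪ (t \ B))` (the configuration with the frozen pattern reversed and the free part kept dominates), then
`0 ≤ Σ_{cell} (F t − F tᶜ)(G t − G tᶜ)`.  (Reindex `Σ_{cell} F tᶜ` by the flip `t ↦ π ∪ (tᶜ \ B)` of the free coordinates, under which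
`tᶜ ↦ (B \ π) ∪ (t \ B)`.)  In the percolation instance `F = f ∘ C_x`, `B` = the edges at the red cluster `S ∌ x` of the avoided set,
`π` = the red edges inside `S`, and `C_x(t) = C_x(t \ B) ⊆ C_x((B \ π) ∪ (t \ B))`.  (prim-lf-2 CW-TLEMMA-gen23 §3.)
[cite: KozmaNitzan2024, Questions 8–9 (§5.5 p. 36) (context)] -/
theorem twoColouring_cell_nonneg_of_le (B π : Finset ι) (hπ : π ⊆ B) (F G : Finset ι → ℝ) (hF : Monotone F) (hG : Monotone G)
    (hFle : ∀ t : Finset ι, t ∩ B = π → F t ≤ F ((B \ π) ∪ (t \ B)))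
    (hGle : ∀ t : Finset ι, t ∩ B = π → G t ≤ G ((B \ π) ∪ (t \ B))) :
    0 ≤ ∑ t ∈ univ.filter (fun t : Finset ι => t ∩ B = π), (F t - F tᶜ) * (G t - G tᶜ) := by
  set cell := univ.filter (fun t : Finset ι => t ∩ B = π) with hcell
  have mem_cell : ∀ t : Finset ι, t ∈ cell ↔ t ∩ B = π := fun t => by simp [hcell]
  -- the flip of the free coordinates
  set τ : Finset ι → Finset ι := fun t => π ∪ (tᶜ \ B) with hτ
  have facts : ∀ t : Finset ι, t ∩ B = π → ∀ i, (i ∈ π ↔ i ∈ t ∧ i ∈ B) := fun t ht i => by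
    rw [← ht]; exact Finset.mem_inter
  have memτ : ∀ t i, i ∈ τ t ↔ i ∈ π ∨ (i ∉ t ∧ i ∉ B) := fun t i => by
    simp only [hτ, Finset.mem_union, Finset.mem_sdiff, Finset.mem_compl]
  have hτcell : ∀ t, t ∩ B = π → τ t ∩ B = π := by
    intro t ht
    ext i
    simp only [Finset.mem_inter, memτ]
    have h1 := facts t ht i
    have h2 : i ∈ π → i ∈ B := fun h => hπ h
    tauto
  have hττ : ∀ t, t ∩ B = π → τ (τ t) = t := by
    intro t ht
    ext i
    rw [memτ, memτ]
    have h1 := facts t ht i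
    have h2 : i ∈ π → i ∈ B := fun h => hπ h
    tauto
  have hflip : ∀ t, t ∩ B = π → tᶜ = (B \ π) ∪ (τ t \ B) := by
    intro t ht
    ext i
    simp only [Finset.mem_compl, Finset.mem_union, Finset.mem_sdiff, memτ]
    have h1 := facts t ht i
    have h2 : i ∈ π → i ∈ B := fun h => hπ h
    tauto
  -- reindex `Σ_{cell} H tᶜ` by the flip
  have reindex : ∀ H : Finset ι → ℝ, ∑ t ∈ cell, H tᶜ = ∑ t ∈ cell, H ((B \ π) ∪ (t \ B)) := by
    intro H
    refine Finset.sum_bij' (fun t _ => τ t) (fun t _ => τ t) ?_ ?_ ?_ ?_ ?_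
    · intro t ht; exact (mem_cell _).mpr (hτcell t ((mem_cell t).mp ht))
    · intro t ht; exact (mem_cell _).mpr (hτcell t ((mem_cell t).mp ht))
    · intro t ht; exact hττ t ((mem_cell t).mp ht)
    · intro t ht; exact hττ t ((mem_cell t).mp ht)
    · intro t ht; rw [hflip t ((mem_cell t).mp ht)]
  have hFc : ∑ t ∈ cell, F t ≤ ∑ t ∈ cell, F tᶜ := by
    rw [reindex F]
    exact Finset.sum_le_sum fun t ht => hFle t ((mem_cell t).mp ht)
  have hGc : ∑ t ∈ cell, G t ≤ ∑ t ∈ cell, G tᶜ := by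
    rw [reindex G]
    exact Finset.sum_le_sum fun t ht => hGle t ((mem_cell t).mp ht)
  exact twoColouring_cell_nonneg B π F G hF hG hFc hGc

end Coefficientwise

end Summit.CriticalPhenomena.PercolationContinuityZ3.Theorems
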